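import Summits.ResolutionOfSingularities.ResolutionOfSingularities.Theorems.FrobeniusLadderFInjectiveMacaulayficationTowerBedChartCM
import HarnessLib

/-!
# BED CI-1 — THE FOUR REES CHARTS `D₊(x̄ⱼt)`, `j = 2, 3, 4, 5`, OF `Bl_𝔪 X` ARE MONIC TOWERS, HENCE COHEN–MACAULAY AT EVERY PRIME
# `X = V(x₀²+x₁³+x₂³+x₃⁴+x₄⁵+x₅⁵, x₀²+2x₁³+3x₂³+4x₃⁴+5x₄⁵+6x₅⁵) ⊂ 𝔸⁶`, `k` ANY field with `3, 4 ≠ 0`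
# (crux `FInjectiveMacaulayfication` stmt-ResolutionOfSingularities-15315, chain w45a; res-L1-w45a-plan-1 RULING R23.11 (2) floor LEGAL column of ROW #11; seat res-L1-w45a-stub-2 g13)

[OURS · L1 W4.5a] Support file (`--supports stmt-ResolutionOfSingularities-15315 --as helper`); def-free; UNCONDITIONAL; replaces the role of NO printed item; NOT a statement of the
manuscript; AI-written (AI review is weaker than expert review). Nothing of the crux is proved.

With `P = 2F₁ − F₂ = x₀² − G`, `Q = F₂ − F₁ = x₁³ + H` and the chart substitution `θⱼ : xᵢ ↦ yᵢyⱼ (i ≠ j)`: `θⱼP = yⱼ²(y₀² − ιGⱼ)`, `θⱼQ = yⱼ³(y₁³ + ιHⱼ)` with `Gⱼ, Hⱼ ∈ k[y₂, …, y₅]`: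
`G₂ = y₂ + 2y₂²y₃⁴ + 3y₂³y₄⁵ + 4y₂³y₅⁵`, `H₂ = 2 + 3y₂y₃⁴ + 4y₂²y₄⁵ + 5y₂²y₅⁵`; `G₃ = y₃y₂³ + 2y₃² + 3y₃³y₄⁵ + 4y₃³y₅⁵`, `H₃ = 2y₂³ + 3y₃ + 4y₃²y₄⁵ + 5y₃²y₅⁵`;
`G₄ = y₄y₂³ + 2y₄²y₃⁴ + 3y₄³ + 4y₄³y₅⁵`, `H₄ = 2y₂³ + 3y₄y₃⁴ + 4y₄² + 5y₄²y₅⁵`; `G₅, H₅` as in ✓ `DiagonalBPCIChart5NotFull`.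
* §1 `no_square_of_spec`, `no_cube_of_spec` — the specialisation mechanism (`2·deg = odd`, `3·deg = N ∤ 3`).
* §2 per chart: the two chart identities (`ring`), the two certificates (specialisations to `k[t]`: `G₂ ↦ t`, `−H₂ ↦ −(3t⁵ + 2)`; `G₃ ↦ t⁷ + 2t²`, `H₃ ↦ 3t`; `G₄ ↦ t⁷ + 3t³`, `H₄ ↦ 4t²`),
  and ★ `cmCl_reesChart_two/three/four/five` — CM at every prime of `D₊(x̄ⱼt)` (✓ `TowerBedChartCM.cmCl_reesChart`).
[cite: Matsumura1987, Thm. 17.4 (iii)] [cite: StacksProject, Tag 0804]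
-/

-- single-problem summit: the doubled namespace component is forced
set_option linter.dupNamespace false

noncomputable section

namespace Summit.ResolutionOfSingularities.ResolutionOfSingularities.Theorems.FInjectiveMacaulayfication.DiagonalBPCIChartsCM

open MvPolynomial IsLocalRing Literature.AlgebraicGeometry.Resolution
open Summit.ResolutionOfSingularities.ResolutionOfSingularities.Theorems.FInjectiveMacaulayfication SliceableCentre

variable (k : Type) [Field k]

/-! ## §1 The specialisation mechanism -/

/-- **No square by specialisation**: if a ring map `s : C → k[t]` sends `G` to a polynomial of ODD degree, then `G` is not a square in `C`. [elementary] -/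
theorem no_square_of_spec (G : MvPolynomial (Fin 4) k) (s : MvPolynomial (Fin 4) k →+* Polynomial k) (q : Polynomial k) (hs : s G = q) (N : ℕ)
    (hq : q.natDegree = N) (hN : ¬ 2 ∣ N) (y : MvPolynomial (Fin 4) k) : y ^ 2 ≠ G := by
  intro h0
  have h1 := congrArg s h0
  rw [map_pow, hs] at h1
  have h2 := congrArg Polynomial.natDegree h1
  rw [Polynomial.natDegree_pow, hq] at h2
  exact hN ⟨_, by rw [← h2, mul_comm]⟩

/-- **No cube by specialisation**: if `s : C → k[t]` sends `H` to a polynomial whose degree is NOT divisible by `3`, then `y³ + H ≠ 0` for all `y ∈ C`. [elementary] -/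
theorem no_cube_of_spec (H : MvPolynomial (Fin 4) k) (s : MvPolynomial (Fin 4) k →+* Polynomial k) (q : Polynomial k) (hs : s H = q) (N : ℕ)
    (hq : q.natDegree = N) (hN : ¬ 3 ∣ N) (y : MvPolynomial (Fin 4) k) : y ^ 3 + H ≠ 0 := by
  intro h0
  have h1 := congrArg s h0
  rw [map_add, map_pow, hs, map_zero] at h1
  have h2 := congrArg Polynomial.natDegree (eq_neg_of_add_eq_zero_left h1)
  rw [Polynomial.natDegree_pow, Polynomial.natDegree_neg, hq] at h2
  exact hN ⟨_, by rw [← h2, mul_comm]⟩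

/-- `natDegree (t^7 + a t^n) = 7` for `n < 7`. [elementary] -/
theorem natDegree_X7_add (a : k) (n : ℕ) (hn : n < 7) : (Polynomial.X ^ 7 + Polynomial.C a * Polynomial.X ^ n : Polynomial k).natDegree = 7 := by
  rw [Polynomial.natDegree_add_eq_left_of_degree_lt, Polynomial.natDegree_X_pow]
  rw [Polynomial.degree_X_pow]
  exact (Polynomial.degree_C_mul_X_pow_le n a).trans_lt (by exact_mod_cast hn)

section Bed

variable (F : Fin 2 → MvPolynomial (Fin 6) k)
  (hF0 : F 0 = X 0 ^ 2 + X 1 ^ 3 + X 2 ^ 3 + X 3 ^ 4 + X 4 ^ 5 + X 5 ^ 5)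
  (hF1 : F 1 = X 0 ^ 2 + C 2 * X 1 ^ 3 + C 3 * X 2 ^ 3 + C 4 * X 3 ^ 4 + C 5 * X 4 ^ 5 + C 6 * X 5 ^ 5)
include hF0 hF1

/-! ## §2 Chart `x₂` -/

set_option linter.unusedSimpArgs false in
-- one `simp only` set serves all chart identities of this file
/-- `θ₂P = y₂²·(y₀² − ιG₂)`. [folklore] -/
theorem theta_P_two : aeval (fun i : Fin 6 => if i = 2 then (X 2 : MvPolynomial (Fin 6) k) else X i * X 2) (C 2 * F 0 - F 1) =
    X 2 ^ 2 * ((![(X 0 : MvPolynomial (Fin 6) k) ^ 2 - MvPolynomial.eval₂Hom MvPolynomial.C ![MvPolynomial.X 2, MvPolynomial.X 3, MvPolynomial.X 4, MvPolynomial.X 5]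
      (X 0 + C 2 * X 0 ^ 2 * X 1 ^ 4 + C 3 * X 0 ^ 3 * X 2 ^ 5 + C 4 * X 0 ^ 3 * X 3 ^ 5 : MvPolynomial (Fin 4) k),
      (X 1 : MvPolynomial (Fin 6) k) ^ 3 + MvPolynomial.eval₂Hom MvPolynomial.C ![MvPolynomial.X 2, MvPolynomial.X 3, MvPolynomial.X 4, MvPolynomial.X 5]
      (C 2 + C 3 * X 0 * X 1 ^ 4 + C 4 * X 0 ^ 2 * X 2 ^ 5 + C 5 * X 0 ^ 2 * X 3 ^ 5 : MvPolynomial (Fin 4) k)] : Fin 2 → MvPolynomial (Fin 6) k) 0) := by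
  rw [hF0, hF1]
  simp only [Matrix.cons_val_zero, map_sub, map_add, map_mul, map_pow, aeval_X, aeval_C, algebraMap_eq, Fin.reduceEq, if_true, if_false, map_ofNat, reduceIte,
    MvPolynomial.eval₂Hom_X', MvPolynomial.eval₂Hom_C, Matrix.cons_val_one, Matrix.cons_val]
  ring

set_option linter.unusedSimpArgs false in
-- one `simp only` set serves all chart identities of this file
/-- `θ₂Q = y₂³·(y₁³ + ιH₂)`. [folklore] -/
theorem theta_Q_two : aeval (fun i : Fin 6 => if i = 2 then (X 2 : MvPolynomial (Fin 6) k) else X i * X 2) (F 1 - F 0) =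
    X 2 ^ 3 * ((![(X 0 : MvPolynomial (Fin 6) k) ^ 2 - MvPolynomial.eval₂Hom MvPolynomial.C ![MvPolynomial.X 2, MvPolynomial.X 3, MvPolynomial.X 4, MvPolynomial.X 5]
      (X 0 + C 2 * X 0 ^ 2 * X 1 ^ 4 + C 3 * X 0 ^ 3 * X 2 ^ 5 + C 4 * X 0 ^ 3 * X 3 ^ 5 : MvPolynomial (Fin 4) k),
      (X 1 : MvPolynomial (Fin 6) k) ^ 3 + MvPolynomial.eval₂Hom MvPolynomial.C ![MvPolynomial.X 2, MvPolynomial.X 3, MvPolynomial.X 4, MvPolynomial.X 5]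
      (C 2 + C 3 * X 0 * X 1 ^ 4 + C 4 * X 0 ^ 2 * X 2 ^ 5 + C 5 * X 0 ^ 2 * X 3 ^ 5 : MvPolynomial (Fin 4) k)] : Fin 2 → MvPolynomial (Fin 6) k) 1) := by
  rw [hF0, hF1]
  simp only [Matrix.cons_val_zero, map_sub, map_add, map_mul, map_pow, aeval_X, aeval_C, algebraMap_eq, Fin.reduceEq, if_true, if_false, map_ofNat, reduceIte,
    MvPolynomial.eval₂Hom_X', MvPolynomial.eval₂Hom_C, Matrix.cons_val_one, Matrix.cons_val]
  ring

omit hF0 hF1 in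
/-- `G₂` is not a square (`G₂ ↦ t` under `y₂ ↦ t`). [elementary] -/
theorem no_square_G₂ (y : MvPolynomial (Fin 4) k) : y ^ 2 ≠ (X 0 + C 2 * X 0 ^ 2 * X 1 ^ 4 + C 3 * X 0 ^ 3 * X 2 ^ 5 + C 4 * X 0 ^ 3 * X 3 ^ 5 : MvPolynomial (Fin 4) k) := by
  refine no_square_of_spec k _ (MvPolynomial.eval₂Hom (Polynomial.C : k →+* Polynomial k) (![Polynomial.X, 0, 0, 0] : Fin 4 → Polynomial k)) Polynomial.X ?_ 1
    Polynomial.natDegree_X (by norm_num) y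
  simp only [map_add, map_mul, map_pow, MvPolynomial.eval₂Hom_X', MvPolynomial.eval₂Hom_C, Matrix.cons_val_zero, Matrix.cons_val_one, Matrix.cons_val]
  ring

omit hF0 hF1 in
/-- `−H₂` is not a cube when `3 ≠ 0` (`H₂ ↦ 3t⁵ + 2` under `y₂, y₃ ↦ t`). [elementary] -/
theorem no_cube_H₂ (h3 : (3 : k) ≠ 0) (y : MvPolynomial (Fin 4) k) :
    y ^ 3 + (C 2 + C 3 * X 0 * X 1 ^ 4 + C 4 * X 0 ^ 2 * X 2 ^ 5 + C 5 * X 0 ^ 2 * X 3 ^ 5 : MvPolynomial (Fin 4) k) ≠ 0 := by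
  refine no_cube_of_spec k _ (MvPolynomial.eval₂Hom (Polynomial.C : k →+* Polynomial k) (![Polynomial.X, Polynomial.X, 0, 0] : Fin 4 → Polynomial k))
    (Polynomial.C 3 * Polynomial.X ^ 5 + Polynomial.C 2) ?_ 5 (by rw [Polynomial.natDegree_add_C, Polynomial.natDegree_C_mul_X_pow 5 (3 : k) h3]) (by norm_num) y
  simp only [map_add, map_mul, map_pow, MvPolynomial.eval₂Hom_X', MvPolynomial.eval₂Hom_C, Matrix.cons_val_zero, Matrix.cons_val_one, Matrix.cons_val]
  ring

/-- ★ **The Rees chart `D₊(x̄₂t)` of `Bl_𝔪 X` is CM at every prime** (`3 ≠ 0` in `k`). [folklore assembly] -/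
theorem cmCl_reesChart_two (h3 : (3 : k) ≠ 0)
    (q : Ideal (HomogeneousLocalization.Away (reesGrading (Ideal.span (Set.range fun i : Fin 6 => Ideal.Quotient.mk (Ideal.span (Set.range F)) (X i))))
      (reesT ((fun i : Fin 6 => Ideal.Quotient.mk (Ideal.span (Set.range F)) (X i)) 2) (Ideal.subset_span (Set.mem_range_self (2 : Fin 6)))))) [q.IsPrime] :
    CMCl (Localization.AtPrime q) :=
  TowerBedChartCM.cmCl_reesChart k F 2 _ _ _ rfl rfl (theta_P_two k F hF0 hF1) (theta_Q_two k F hF0 hF1) (no_square_G₂ k) (no_cube_H₂ k h3) (by simp [constantCoeff_X])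
    (by simp [constantCoeff_X]; norm_num; exact h3) 0 rfl q

/-! ## §3 Chart `x₃` -/

set_option linter.unusedSimpArgs false in
-- one `simp only` set serves all chart identities of this file
/-- `θ₃P = y₃²·(y₀² − ιG₃)`. [folklore] -/
theorem theta_P_three : aeval (fun i : Fin 6 => if i = 3 then (X 3 : MvPolynomial (Fin 6) k) else X i * X 3) (C 2 * F 0 - F 1) =
    X 3 ^ 2 * ((![(X 0 : MvPolynomial (Fin 6) k) ^ 2 - MvPolynomial.eval₂Hom MvPolynomial.C ![MvPolynomial.X 2, MvPolynomial.X 3, MvPolynomial.X 4, MvPolynomial.X 5]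
      (X 1 * X 0 ^ 3 + C 2 * X 1 ^ 2 + C 3 * X 1 ^ 3 * X 2 ^ 5 + C 4 * X 1 ^ 3 * X 3 ^ 5 : MvPolynomial (Fin 4) k),
      (X 1 : MvPolynomial (Fin 6) k) ^ 3 + MvPolynomial.eval₂Hom MvPolynomial.C ![MvPolynomial.X 2, MvPolynomial.X 3, MvPolynomial.X 4, MvPolynomial.X 5]
      (C 2 * X 0 ^ 3 + C 3 * X 1 + C 4 * X 1 ^ 2 * X 2 ^ 5 + C 5 * X 1 ^ 2 * X 3 ^ 5 : MvPolynomial (Fin 4) k)] : Fin 2 → MvPolynomial (Fin 6) k) 0) := by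
  rw [hF0, hF1]
  simp only [Matrix.cons_val_zero, map_sub, map_add, map_mul, map_pow, aeval_X, aeval_C, algebraMap_eq, Fin.reduceEq, if_true, if_false, map_ofNat, reduceIte,
    MvPolynomial.eval₂Hom_X', MvPolynomial.eval₂Hom_C, Matrix.cons_val_one, Matrix.cons_val]
  ring

set_option linter.unusedSimpArgs false in
-- one `simp only` set serves all chart identities of this file
/-- `θ₃Q = y₃³·(y₁³ + ιH₃)`. [folklore] -/
theorem theta_Q_three : aeval (fun i : Fin 6 => if i = 3 then (X 3 : MvPolynomial (Fin 6) k) else X i * X 3) (F 1 - F 0) =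
    X 3 ^ 3 * ((![(X 0 : MvPolynomial (Fin 6) k) ^ 2 - MvPolynomial.eval₂Hom MvPolynomial.C ![MvPolynomial.X 2, MvPolynomial.X 3, MvPolynomial.X 4, MvPolynomial.X 5]
      (X 1 * X 0 ^ 3 + C 2 * X 1 ^ 2 + C 3 * X 1 ^ 3 * X 2 ^ 5 + C 4 * X 1 ^ 3 * X 3 ^ 5 : MvPolynomial (Fin 4) k),
      (X 1 : MvPolynomial (Fin 6) k) ^ 3 + MvPolynomial.eval₂Hom MvPolynomial.C ![MvPolynomial.X 2, MvPolynomial.X 3, MvPolynomial.X 4, MvPolynomial.X 5]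
      (C 2 * X 0 ^ 3 + C 3 * X 1 + C 4 * X 1 ^ 2 * X 2 ^ 5 + C 5 * X 1 ^ 2 * X 3 ^ 5 : MvPolynomial (Fin 4) k)] : Fin 2 → MvPolynomial (Fin 6) k) 1) := by
  rw [hF0, hF1]
  simp only [Matrix.cons_val_zero, map_sub, map_add, map_mul, map_pow, aeval_X, aeval_C, algebraMap_eq, Fin.reduceEq, if_true, if_false, map_ofNat, reduceIte,
    MvPolynomial.eval₂Hom_X', MvPolynomial.eval₂Hom_C, Matrix.cons_val_one, Matrix.cons_val]
  ring

omit hF0 hF1 in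
/-- `G₃` is not a square (`G₃ ↦ t⁷ + 2t²` under `y₂ ↦ t²`, `y₃ ↦ t`). [elementary] -/
theorem no_square_G₃ (y : MvPolynomial (Fin 4) k) : y ^ 2 ≠ (X 1 * X 0 ^ 3 + C 2 * X 1 ^ 2 + C 3 * X 1 ^ 3 * X 2 ^ 5 + C 4 * X 1 ^ 3 * X 3 ^ 5 : MvPolynomial (Fin 4) k) := by
  refine no_square_of_spec k _ (MvPolynomial.eval₂Hom (Polynomial.C : k →+* Polynomial k) (![Polynomial.X ^ 2, Polynomial.X, 0, 0] : Fin 4 → Polynomial k))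
    (Polynomial.X ^ 7 + Polynomial.C 2 * Polynomial.X ^ 2) ?_ 7 (natDegree_X7_add k 2 2 (by norm_num)) (by norm_num) y
  simp only [map_add, map_mul, map_pow, MvPolynomial.eval₂Hom_X', MvPolynomial.eval₂Hom_C, Matrix.cons_val_zero, Matrix.cons_val_one, Matrix.cons_val]
  ring

omit hF0 hF1 in
/-- `−H₃` is not a cube when `3 ≠ 0` (`H₃ ↦ 3t` under `y₃ ↦ t`). [elementary] -/
theorem no_cube_H₃ (h3 : (3 : k) ≠ 0) (y : MvPolynomial (Fin 4) k) :
    y ^ 3 + (C 2 * X 0 ^ 3 + C 3 * X 1 + C 4 * X 1 ^ 2 * X 2 ^ 5 + C 5 * X 1 ^ 2 * X 3 ^ 5 : MvPolynomial (Fin 4) k) ≠ 0 := by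
  refine no_cube_of_spec k _ (MvPolynomial.eval₂Hom (Polynomial.C : k →+* Polynomial k) (![0, Polynomial.X, 0, 0] : Fin 4 → Polynomial k))
    (Polynomial.C 3 * Polynomial.X) ?_ 1 (Polynomial.natDegree_C_mul_X 3 h3) (by norm_num) y
  simp only [map_add, map_mul, map_pow, MvPolynomial.eval₂Hom_X', MvPolynomial.eval₂Hom_C, Matrix.cons_val_zero, Matrix.cons_val_one, Matrix.cons_val]
  ring

/-- ★ **The Rees chart `D₊(x̄₃t)` of `Bl_𝔪 X` is CM at every prime** (`3 ≠ 0` in `k`). [folklore assembly] -/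
theorem cmCl_reesChart_three (h3 : (3 : k) ≠ 0)
    (q : Ideal (HomogeneousLocalization.Away (reesGrading (Ideal.span (Set.range fun i : Fin 6 => Ideal.Quotient.mk (Ideal.span (Set.range F)) (X i))))
      (reesT ((fun i : Fin 6 => Ideal.Quotient.mk (Ideal.span (Set.range F)) (X i)) 3) (Ideal.subset_span (Set.mem_range_self (3 : Fin 6)))))) [q.IsPrime] :
    CMCl (Localization.AtPrime q) :=
  TowerBedChartCM.cmCl_reesChart k F 3 _ _ _ rfl rfl (theta_P_three k F hF0 hF1) (theta_Q_three k F hF0 hF1) (no_square_G₃ k) (no_cube_H₃ k h3) (by simp [constantCoeff_X])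
    (by simp [constantCoeff_X]) 1 rfl q

/-! ## §4 Chart `x₄` -/

set_option linter.unusedSimpArgs false in
-- one `simp only` set serves all chart identities of this file
/-- `θ₄P = y₄²·(y₀² − ιG₄)`. [folklore] -/
theorem theta_P_four : aeval (fun i : Fin 6 => if i = 4 then (X 4 : MvPolynomial (Fin 6) k) else X i * X 4) (C 2 * F 0 - F 1) =
    X 4 ^ 2 * ((![(X 0 : MvPolynomial (Fin 6) k) ^ 2 - MvPolynomial.eval₂Hom MvPolynomial.C ![MvPolynomial.X 2, MvPolynomial.X 3, MvPolynomial.X 4, MvPolynomial.X 5]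
      (X 2 * X 0 ^ 3 + C 2 * X 2 ^ 2 * X 1 ^ 4 + C 3 * X 2 ^ 3 + C 4 * X 2 ^ 3 * X 3 ^ 5 : MvPolynomial (Fin 4) k),
      (X 1 : MvPolynomial (Fin 6) k) ^ 3 + MvPolynomial.eval₂Hom MvPolynomial.C ![MvPolynomial.X 2, MvPolynomial.X 3, MvPolynomial.X 4, MvPolynomial.X 5]
      (C 2 * X 0 ^ 3 + C 3 * X 2 * X 1 ^ 4 + C 4 * X 2 ^ 2 + C 5 * X 2 ^ 2 * X 3 ^ 5 : MvPolynomial (Fin 4) k)] : Fin 2 → MvPolynomial (Fin 6) k) 0) := by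
  rw [hF0, hF1]
  simp only [Matrix.cons_val_zero, map_sub, map_add, map_mul, map_pow, aeval_X, aeval_C, algebraMap_eq, Fin.reduceEq, if_true, if_false, map_ofNat, reduceIte,
    MvPolynomial.eval₂Hom_X', MvPolynomial.eval₂Hom_C, Matrix.cons_val_one, Matrix.cons_val]
  ring

set_option linter.unusedSimpArgs false in
-- one `simp only` set serves all chart identities of this file
/-- `θ₄Q = y₄³·(y₁³ + ιH₄)`. [folklore] -/
theorem theta_Q_four : aeval (fun i : Fin 6 => if i = 4 then (X 4 : MvPolynomial (Fin 6) k) else X i * X 4) (F 1 - F 0) =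
    X 4 ^ 3 * ((![(X 0 : MvPolynomial (Fin 6) k) ^ 2 - MvPolynomial.eval₂Hom MvPolynomial.C ![MvPolynomial.X 2, MvPolynomial.X 3, MvPolynomial.X 4, MvPolynomial.X 5]
      (X 2 * X 0 ^ 3 + C 2 * X 2 ^ 2 * X 1 ^ 4 + C 3 * X 2 ^ 3 + C 4 * X 2 ^ 3 * X 3 ^ 5 : MvPolynomial (Fin 4) k),
      (X 1 : MvPolynomial (Fin 6) k) ^ 3 + MvPolynomial.eval₂Hom MvPolynomial.C ![MvPolynomial.X 2, MvPolynomial.X 3, MvPolynomial.X 4, MvPolynomial.X 5]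
      (C 2 * X 0 ^ 3 + C 3 * X 2 * X 1 ^ 4 + C 4 * X 2 ^ 2 + C 5 * X 2 ^ 2 * X 3 ^ 5 : MvPolynomial (Fin 4) k)] : Fin 2 → MvPolynomial (Fin 6) k) 1) := by
  rw [hF0, hF1]
  simp only [Matrix.cons_val_zero, map_sub, map_add, map_mul, map_pow, aeval_X, aeval_C, algebraMap_eq, Fin.reduceEq, if_true, if_false, map_ofNat, reduceIte,
    MvPolynomial.eval₂Hom_X', MvPolynomial.eval₂Hom_C, Matrix.cons_val_one, Matrix.cons_val]
  ring

omit hF0 hF1 in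
/-- `G₄` is not a square (`G₄ ↦ t⁷ + 3t³` under `y₂ ↦ t²`, `y₄ ↦ t`). [elementary] -/
theorem no_square_G₄ (y : MvPolynomial (Fin 4) k) : y ^ 2 ≠ (X 2 * X 0 ^ 3 + C 2 * X 2 ^ 2 * X 1 ^ 4 + C 3 * X 2 ^ 3 + C 4 * X 2 ^ 3 * X 3 ^ 5 : MvPolynomial (Fin 4) k) := by
  refine no_square_of_spec k _ (MvPolynomial.eval₂Hom (Polynomial.C : k →+* Polynomial k) (![Polynomial.X ^ 2, 0, Polynomial.X, 0] : Fin 4 → Polynomial k))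
    (Polynomial.X ^ 7 + Polynomial.C 3 * Polynomial.X ^ 3) ?_ 7 (natDegree_X7_add k 3 3 (by norm_num)) (by norm_num) y
  simp only [map_add, map_mul, map_pow, MvPolynomial.eval₂Hom_X', MvPolynomial.eval₂Hom_C, Matrix.cons_val_zero, Matrix.cons_val_one, Matrix.cons_val]
  ring

omit hF0 hF1 in
/-- `−H₄` is not a cube when `4 ≠ 0` (`H₄ ↦ 4t²` under `y₄ ↦ t`). [elementary] -/
theorem no_cube_H₄ (h4 : (4 : k) ≠ 0) (y : MvPolynomial (Fin 4) k) :
    y ^ 3 + (C 2 * X 0 ^ 3 + C 3 * X 2 * X 1 ^ 4 + C 4 * X 2 ^ 2 + C 5 * X 2 ^ 2 * X 3 ^ 5 : MvPolynomial (Fin 4) k) ≠ 0 := by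
  refine no_cube_of_spec k _ (MvPolynomial.eval₂Hom (Polynomial.C : k →+* Polynomial k) (![0, 0, Polynomial.X, 0] : Fin 4 → Polynomial k))
    (Polynomial.C 4 * Polynomial.X ^ 2) ?_ 2 (Polynomial.natDegree_C_mul_X_pow 2 (4 : k) h4) (by norm_num) y
  simp only [map_add, map_mul, map_pow, MvPolynomial.eval₂Hom_X', MvPolynomial.eval₂Hom_C, Matrix.cons_val_zero, Matrix.cons_val_one, Matrix.cons_val]
  ring

/-- ★ **The Rees chart `D₊(x̄₄t)` of `Bl_𝔪 X` is CM at every prime** (`4 ≠ 0` in `k`). [folklore assembly] -/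
theorem cmCl_reesChart_four (h4 : (4 : k) ≠ 0)
    (q : Ideal (HomogeneousLocalization.Away (reesGrading (Ideal.span (Set.range fun i : Fin 6 => Ideal.Quotient.mk (Ideal.span (Set.range F)) (X i))))
      (reesT ((fun i : Fin 6 => Ideal.Quotient.mk (Ideal.span (Set.range F)) (X i)) 4) (Ideal.subset_span (Set.mem_range_self (4 : Fin 6)))))) [q.IsPrime] :
    CMCl (Localization.AtPrime q) :=
  TowerBedChartCM.cmCl_reesChart k F 4 _ _ _ rfl rfl (theta_P_four k F hF0 hF1) (theta_Q_four k F hF0 hF1) (no_square_G₄ k) (no_cube_H₄ k h4) (by simp [constantCoeff_X])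
    (by simp [constantCoeff_X]) 2 rfl q

/-! ## §5 Chart `x₅` (certificates from ✓ `DiagonalBPCIChart5NotFull`) -/

set_option linter.unusedSimpArgs false in
-- one `simp only` set serves all chart identities of this file
/-- `θ₅P = y₅²·(y₀² − ιG₅)`. [folklore] -/
theorem theta_P_five : aeval (fun i : Fin 6 => if i = 5 then (X 5 : MvPolynomial (Fin 6) k) else X i * X 5) (C 2 * F 0 - F 1) =
    X 5 ^ 2 * ((![(X 0 : MvPolynomial (Fin 6) k) ^ 2 - MvPolynomial.eval₂Hom MvPolynomial.C ![MvPolynomial.X 2, MvPolynomial.X 3, MvPolynomial.X 4, MvPolynomial.X 5]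
      (X 3 * X 0 ^ 3 + C 2 * X 3 ^ 2 * X 1 ^ 4 + C 3 * X 3 ^ 3 * X 2 ^ 5 + C 4 * X 3 ^ 3 : MvPolynomial (Fin 4) k),
      (X 1 : MvPolynomial (Fin 6) k) ^ 3 + MvPolynomial.eval₂Hom MvPolynomial.C ![MvPolynomial.X 2, MvPolynomial.X 3, MvPolynomial.X 4, MvPolynomial.X 5]
      (C 2 * X 0 ^ 3 + C 3 * X 3 * X 1 ^ 4 + C 4 * X 3 ^ 2 * X 2 ^ 5 + C 5 * X 3 ^ 2 : MvPolynomial (Fin 4) k)] : Fin 2 → MvPolynomial (Fin 6) k) 0) := by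
  rw [hF0, hF1]
  simp only [Matrix.cons_val_zero, map_sub, map_add, map_mul, map_pow, aeval_X, aeval_C, algebraMap_eq, Fin.reduceEq, if_true, if_false, map_ofNat, reduceIte,
    MvPolynomial.eval₂Hom_X', MvPolynomial.eval₂Hom_C, Matrix.cons_val_one, Matrix.cons_val]
  ring

set_option linter.unusedSimpArgs false in
-- one `simp only` set serves all chart identities of this file
/-- `θ₅Q = y₅³·(y₁³ + ιH₅)`. [folklore] -/
theorem theta_Q_five : aeval (fun i : Fin 6 => if i = 5 then (X 5 : MvPolynomial (Fin 6) k) else X i * X 5) (F 1 - F 0) =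
    X 5 ^ 3 * ((![(X 0 : MvPolynomial (Fin 6) k) ^ 2 - MvPolynomial.eval₂Hom MvPolynomial.C ![MvPolynomial.X 2, MvPolynomial.X 3, MvPolynomial.X 4, MvPolynomial.X 5]
      (X 3 * X 0 ^ 3 + C 2 * X 3 ^ 2 * X 1 ^ 4 + C 3 * X 3 ^ 3 * X 2 ^ 5 + C 4 * X 3 ^ 3 : MvPolynomial (Fin 4) k),
      (X 1 : MvPolynomial (Fin 6) k) ^ 3 + MvPolynomial.eval₂Hom MvPolynomial.C ![MvPolynomial.X 2, MvPolynomial.X 3, MvPolynomial.X 4, MvPolynomial.X 5]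
      (C 2 * X 0 ^ 3 + C 3 * X 3 * X 1 ^ 4 + C 4 * X 3 ^ 2 * X 2 ^ 5 + C 5 * X 3 ^ 2 : MvPolynomial (Fin 4) k)] : Fin 2 → MvPolynomial (Fin 6) k) 1) := by
  rw [hF0, hF1]
  simp only [Matrix.cons_val_zero, map_sub, map_add, map_mul, map_pow, aeval_X, aeval_C, algebraMap_eq, Fin.reduceEq, if_true, if_false, map_ofNat, reduceIte,
    MvPolynomial.eval₂Hom_X', MvPolynomial.eval₂Hom_C, Matrix.cons_val_one, Matrix.cons_val]
  ring

/-- ★ **The Rees chart `D₊(x̄₅t)` of `Bl_𝔪 X` is CM at every prime** (`3 ≠ 0` in `k`). [folklore assembly] -/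
theorem cmCl_reesChart_five (h3 : (3 : k) ≠ 0)
    (q : Ideal (HomogeneousLocalization.Away (reesGrading (Ideal.span (Set.range fun i : Fin 6 => Ideal.Quotient.mk (Ideal.span (Set.range F)) (X i))))
      (reesT ((fun i : Fin 6 => Ideal.Quotient.mk (Ideal.span (Set.range F)) (X i)) 5) (Ideal.subset_span (Set.mem_range_self (5 : Fin 6)))))) [q.IsPrime] :
    CMCl (Localization.AtPrime q) :=
  TowerBedChartCM.cmCl_reesChart k F 5 _ _ _ rfl rfl (theta_P_five k F hF0 hF1) (theta_Q_five k F hF0 hF1) (DiagonalBPCIChart5NotFull.no_square_G₅ k _ rfl)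
    (DiagonalBPCIChart5NotFull.no_cube_H₅ k h3 _ rfl) (by simp [constantCoeff_X]) (by simp [constantCoeff_X]) 3 rfl q

end Bed

end Summit.ResolutionOfSingularities.ResolutionOfSingularities.Theorems.FInjectiveMacaulayfication.DiagonalBPCIChartsCM

end
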